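import Summits.QuantumFields.BalabanUV.T4Continuum.Support.NE3FramePotBoundComplex
import Summits.QuantumFields.BalabanUV.T4Continuum.Support.NE3TangentFlatStructure
import Summits.QuantumFields.BalabanUV.T4Continuum.Support.NE7ApeFlatSkeleton
import Summits.QuantumFields.BalabanUV.T4Continuum.Support.NE3SmoothLiftCurl
import Summits.QuantumFields.BalabanUV.T4Continuum.Support.BalabanAveragedTowerUnit
import HarnessLib

/-!
# NE7FlatSliceRankOne — row NE7 (node U5), the (A)-bill's XL(c) docking, file D3 of `t4/b2b-balaban-t4-ne7-p2/g84/XLC-DOCKING-MEMO.md`: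
# THE SLICE SOLVER LETTER `G♭` ON BAŁABAN's STRAIGHT SLICE FOR `𝔲(n)`-VALUED FIELDS FOLLOWS FROM THE SAME LETTER AT RANK ONE
# (`Matrix (Fin 1) (Fin 1) ℂ`, i.e. one purely imaginary scalar field), constant `2·n³·K` — at the flat background everything is entrywise

Lineage `b2b-balaban-t4-ne7-p2` (CRUX PROVER NE7 #2, co-owner of row NE7), generation 84; companion of (137)–(140) (`NE7FlatSliceSourceDuality`,
`NE7FlatSliceNormalForm`, `NE7FlatSliceStraightReduction`, `NE7ConstrainedGreenIdentity`).  Over `NE3FramePotBoundComplex.iterate_Qcoarse_map` (the straight average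
commutes with every `ℂ`-linear map of the coefficients), `NE3SmoothLiftCurl.curlAt_flat_eq` (the flat curl is a 4-term linear combination), `NE7ApeFlatSkeleton.hess_flat`
(the flat Hessian is the curl pairing `−Σ Re tr(curl Y·curl X)∕n`), `BalabanAveragedTowerUnit.norm_entry_le_opNorm` and `MatrixNorms.opNorm_sq_le_card_mul_nhsNormSq`.
WHY.  After (139) the XL(c) driver is the letter `G♭` on the straight slice `{skew, P-periodic, (Qcoarse L)^[j] · = 0}` of `M_n(ℂ)`-valued fields; lit-balaban's B5
propagator bounds ((1.115), `B5Prop12GHolds`) are SCALAR (one real component at a time).  THIS FILE reduces the matrix letter to the rank-one letter ON THE SAME T4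
OBJECTS (`hess`, `curlAt`, `dirL1`, `Qcoarse` at `n := Fin 1`), so the docking (D5) is a statement about ONE imaginary scalar field: **`straightSliceSolver_of_rankOne`**
— the rank-one letter with constant `K` implies the rank-`n` letter with constant `2·n³·K` (`n = card n`), for every `L, j, P`.
HOW ([folklore]).  PROBES: for a Hermitian `T ∈ M_n(ℂ)`, the `ℂ`-linear extraction `exT T C = (tr(T·C)∕2)·1 ∈ M₁(ℂ)` and embedding `emT T B = B₀₀·T`; both preserve
skewness (`exT_mem_skewAdjoint`, `emT_mem_skewAdjoint`), commute with the straight average (`iterate_Qcoarse_map`) and with the flat curl (`curlAt_flat_map`), and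
INTERTWINE THE HESSIANS: `hess 1 X (emT T ∘ ζ) W = (2∕n)·hess 1 (exT T ∘ X) ζ W` (**`hess_flat_emT`**, from `Re tr((B₀₀T)·C)∕n = (2∕n)·Re tr(B·(tr(TC)∕2))`); cost
`‖emT T B‖ ≤ ‖T‖·‖B‖`.  So a functional bound `g` for `X` against straight-slice tests yields the bound `n‖T‖g∕2` for `exT T ∘ X` against rank-one straight-slice
tests, hence `‖exT T (curl X)‖ ≤ K·n·‖T‖·g∕2`; the probes `T = E_ba + E_ab`, `i(E_ba − E_ab)` (Hermitian, norm `≤ 2`) recover every entry `|curl X_ab| ≤ 2nK·g`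
(`norm_entry_le_probes`), and `‖C‖ ≤ Σ_ab |C_ab|` (`opNorm_le_sum_norm_entries`).
HONEST FRAMING (page 1): [folklore] entrywise bookkeeping at the FLAT configuration; NO estimate — the rank-one letter `h1` is a DISPLAYED HYPOTHESIS (the XL(c)
content); nothing of Bałaban's asserted; NOT (APE), NOT ONE-STEP, NOT NE7; spine 0∕9; finite T⁴ rung (B)+1 — NOT infinite volume, NOT mass gap, NOT Clay.  Continuum
YM on T⁴ ⇐ BetaPertH ∧ nine spine estimates (0/9 proved); BetaPertH ⇐ (D1) ∧ (D4) ∧ CAP+tail; G-an2-4 gates asym, D1 and NE2/3/4.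
-/

set_option autoImplicit false

open scoped BigOperators Matrix Matrix.Norms.L2Operator ComplexConjugate
open NormedSpace Finset

namespace Summit.QuantumFields.BalabanUV.T4Continuum.NE7FlatSliceRankOne

open Literature.MathematicalPhysics.QuantumFieldTheory.Balaban1983to89
open B7Prop1Explicit B7Prop2Explicit UnitaryModel MatrixNorms
open T4AveragingDeficitWall hiding Site Plane Plaq Bond
open T4AveragingDeficitWallBoundary (periodBox)
open AveragingDeficitPeriodicCounting (IsPeriodicDir)
open MinimalActionLevels (perWin)
open BlockAveragePushDirSplit (flat)
open NE3HessForm (hess)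
open NE3SmoothLiftCurl (curlAt_flat_eq)
open NE3TangentFlatStructure (Qcoarse)
open NE3FramePotBoundComplex (iterate_Qcoarse_map)
open BalabanAveragedTowerUnit (norm_entry_le_opNorm)

noncomputable section

variable {d : ℕ} {n : Type*} [Fintype n] [DecidableEq n]

local notation "𝕄" => Matrix n n ℂ
local notation "𝕄₁" => Matrix (Fin 1) (Fin 1) ℂ

/-! ## §1 Rank-one skewness; the probes (extraction and embedding along a Hermitian direction) -/

/-- A skew `1×1` matrix has purely imaginary entry: `conj B₀₀ = −B₀₀`. [folklore] -/
theorem conj_entry_of_mem_skewAdjoint {B : 𝕄₁} (hB : B ∈ skewAdjoint 𝕄₁) : conj (B 0 0) = -B 0 0 := by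
  have h00 : (star B) 0 0 = (-B) 0 0 := by rw [skewAdjoint.mem_iff.mp hB]
  rwa [Matrix.star_apply, Matrix.neg_apply, Complex.star_def] at h00

/-- A `1×1` matrix `c·1` with `conj c = −c` is skew. [folklore] -/
theorem smul_one_mem_skewAdjoint {c : ℂ} (hc : conj c = -c) : c • (1 : 𝕄₁) ∈ skewAdjoint 𝕄₁ := by
  rw [skewAdjoint.mem_iff, star_smul, star_one, ← neg_smul]
  exact congrArg (· • (1 : 𝕄₁)) hc

/-- **EXTRACTION** along `T`: `exT T C = (tr(T·C)∕2)·1 ∈ M₁(ℂ)` (`ℂ`-linear in `C`). [folklore] -/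
def exT (T : 𝕄) : 𝕄 →ₗ[ℂ] 𝕄₁ where
  toFun C := ((2 : ℂ)⁻¹ * (T * C).trace) • (1 : 𝕄₁)
  map_add' C C' := by rw [mul_add, Matrix.trace_add, mul_add, add_smul]
  map_smul' c C := by rw [Matrix.mul_smul, Matrix.trace_smul, smul_eq_mul, RingHom.id_apply, smul_smul]; ring_nf

/-- **EMBEDDING** along `T`: `emT T B = B₀₀·T ∈ M_n(ℂ)` (`ℂ`-linear in `B`). [folklore] -/
def emT (T : 𝕄) : 𝕄₁ →ₗ[ℂ] 𝕄 where
  toFun B := B 0 0 • T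
  map_add' B B' := by rw [Matrix.add_apply, add_smul]
  map_smul' c B := by rw [Matrix.smul_apply, smul_eq_mul, RingHom.id_apply, smul_smul]

/-- unfolding. [folklore] -/
theorem exT_apply (T C : 𝕄) : exT T C = ((2 : ℂ)⁻¹ * (T * C).trace) • (1 : 𝕄₁) := rfl

omit [Fintype n] [DecidableEq n] in
/-- unfolding. [folklore] -/
theorem emT_apply (T : 𝕄) (B : 𝕄₁) : emT T B = B 0 0 • T := rfl

/-- **THE TRACE INTERTWINING**: `Re tr(emT T B · C)∕n = (2∕n)·Re tr(B · exT T C)` (rank one on the right). [folklore] -/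
theorem nReTr_emT_mul (T C : 𝕄) (B : 𝕄₁) : nReTr (emT T B * C) = (2 / Fintype.card n) * nReTr (B * exT T C) := by
  unfold UnitaryModel.nReTr
  rw [emT_apply, exT_apply, Matrix.smul_mul, Matrix.trace_smul, Matrix.mul_smul, Matrix.mul_one, Matrix.trace_smul, smul_eq_mul, smul_eq_mul,
    Matrix.trace_fin_one, Fintype.card_fin, Nat.cast_one, div_one]
  have e : ((2 : ℂ)⁻¹ * (T * C).trace * B 0 0).re = 2⁻¹ * (B 0 0 * (T * C).trace).re := by
    rw [show (2 : ℂ)⁻¹ * (T * C).trace * B 0 0 = ((2⁻¹ : ℝ) : ℂ) * (B 0 0 * (T * C).trace) by push_cast; ring, Complex.re_ofReal_mul]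
  rw [e]
  field_simp

omit [DecidableEq n] in
/-- For a Hermitian probe `T` and a skew `C`, `tr(T·C)` is purely imaginary. [folklore] -/
theorem conj_trace_mul_of_skew {T C : 𝕄} (hT : T ∈ selfAdjoint 𝕄) (hC : C ∈ skewAdjoint 𝕄) : conj ((T * C).trace) = -(T * C).trace := by
  have hT' : Tᴴ = T := by rw [← Matrix.star_eq_conjTranspose]; exact selfAdjoint.mem_iff.mp hT
  have hC' : Cᴴ = -C := by rw [← Matrix.star_eq_conjTranspose]; exact skewAdjoint.mem_iff.mp hC
  rw [← Complex.star_def, ← Matrix.trace_conjTranspose, Matrix.conjTranspose_mul, hT', hC', neg_mul, Matrix.trace_neg, Matrix.trace_mul_comm]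

/-- The extraction of a skew matrix along a HERMITIAN probe is skew. [folklore] -/
theorem exT_mem_skewAdjoint {T C : 𝕄} (hT : T ∈ selfAdjoint 𝕄) (hC : C ∈ skewAdjoint 𝕄) : exT T C ∈ skewAdjoint 𝕄₁ := by
  rw [exT_apply]
  refine smul_one_mem_skewAdjoint ?_
  rw [map_mul, conj_trace_mul_of_skew hT hC, map_inv₀, show conj (2 : ℂ) = 2 from map_ofNat _ 2, mul_neg]

omit [Fintype n] [DecidableEq n] in
/-- The embedding of a skew `1×1` matrix along a HERMITIAN probe is skew. [folklore] -/
theorem emT_mem_skewAdjoint {T : 𝕄} (hT : T ∈ selfAdjoint 𝕄) {B : 𝕄₁} (hB : B ∈ skewAdjoint 𝕄₁) : emT T B ∈ skewAdjoint 𝕄 := by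
  have hT' : star T = T := selfAdjoint.mem_iff.mp hT
  rw [skewAdjoint.mem_iff, emT_apply, star_smul, hT', Complex.star_def, conj_entry_of_mem_skewAdjoint hB, neg_smul]

/-- `‖emT T B‖ ≤ ‖T‖·‖B‖`. [folklore] -/
theorem norm_emT_le (T : 𝕄) (B : 𝕄₁) : ‖emT T B‖ ≤ ‖T‖ * ‖B‖ := by
  rw [emT_apply, norm_smul, mul_comm]
  exact mul_le_mul_of_nonneg_left (norm_entry_le_opNorm B 0 0) (norm_nonneg _)

/-- `‖exT T C‖ ≤ ‖T‖·‖C‖·n∕2`-free form used below: `‖exT T C‖ = ‖tr(T·C)‖∕2`. [folklore] -/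
theorem norm_exT (T C : 𝕄) : ‖exT T C‖ = ‖(T * C).trace‖ / 2 := by
  rw [exT_apply, norm_smul, norm_one, mul_one, norm_mul, norm_inv, Complex.norm_ofNat]
  ring

/-! ## §2 The probes commute with the straight average and the flat curl; the Hessians intertwine -/

omit [Fintype n] [DecidableEq n] in
/-- The flat curl commutes with every additive map of the coefficients. [folklore] -/
theorem curlAt_flat_map {𝔸 𝔹 : Type*} [Fintype 𝔸] [DecidableEq 𝔸] [Fintype 𝔹] [DecidableEq 𝔹]
    (φ : Matrix 𝔸 𝔸 ℂ →ₗ[ℂ] Matrix 𝔹 𝔹 ℂ) (X : Site d → Fin d → Matrix 𝔸 𝔸 ℂ) (z : Site d) (μ ν : Fin d) :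
    curlAt (flat (d := d) (n := 𝔹)) (fun y κ => φ (X y κ)) z μ ν = φ (curlAt (flat (d := d) (n := 𝔸)) X z μ ν) := by
  rw [curlAt_flat_eq, curlAt_flat_eq, map_sub, map_sub, map_sub]

/-- **THE HESSIANS INTERTWINE**: `hess 1 X (emT T ∘ ζ) W = (2∕n)·hess 1 (exT T ∘ X) ζ W`. [folklore] -/
theorem hess_flat_emT (T : 𝕄) (X : Site d → Fin d → 𝕄) (ζ : Site d → Fin d → 𝕄₁) (W : Finset (T4AveragingDeficitWall.Plaq d)) :
    hess (flat (d := d) (n := n)) X (fun y κ => emT T (ζ y κ)) W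
      = (2 / Fintype.card n) * hess (flat (d := d) (n := Fin 1)) (fun y κ => exT T (X y κ)) ζ W := by
  rw [NE7ApeFlatSkeleton.hess_flat (flat_mem_classes (d := d) (n := n) le_rfl).2,
    NE7ApeFlatSkeleton.hess_flat (flat_mem_classes (d := d) (n := Fin 1) le_rfl).2, mul_neg, Finset.mul_sum]
  congr 1
  refine Finset.sum_congr rfl fun p _ => ?_
  show nReTr (curlAt _ (fun y κ => emT T (ζ y κ)) p.1 p.2.1.1 p.2.1.2 * curlAt _ X p.1 p.2.1.1 p.2.1.2)
    = 2 / Fintype.card n * nReTr (curlAt _ ζ p.1 p.2.1.1 p.2.1.2 * curlAt _ (fun y κ => exT T (X y κ)) p.1 p.2.1.1 p.2.1.2)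
  rw [curlAt_flat_map, curlAt_flat_map, nReTr_emT_mul]

/-! ## §3 Entries from probes; the operator norm from the entries -/

/-- The two Hermitian probes of the entry `(a, b)`: `T₁ = E_ba + E_ab`, `T₂ = i·(E_ba − E_ab)`. [folklore] -/
def probe₁ (a b : n) : 𝕄 := Matrix.single b a 1 + Matrix.single a b 1

/-- see `probe₁`. [folklore] -/
def probe₂ (a b : n) : 𝕄 := Complex.I • (Matrix.single b a 1 - Matrix.single a b 1)

omit [Fintype n] in
/-- `probe₁` is Hermitian. [folklore] -/
theorem probe₁_mem_selfAdjoint (a b : n) : probe₁ a b ∈ selfAdjoint 𝕄 := by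
  rw [selfAdjoint.mem_iff, probe₁, Matrix.star_eq_conjTranspose, Matrix.conjTranspose_add, Matrix.conjTranspose_single,
    Matrix.conjTranspose_single, star_one, add_comm]

omit [Fintype n] in
/-- `probe₂` is Hermitian. [folklore] -/
theorem probe₂_mem_selfAdjoint (a b : n) : probe₂ a b ∈ selfAdjoint 𝕄 := by
  rw [selfAdjoint.mem_iff, probe₂, Matrix.star_eq_conjTranspose, Matrix.conjTranspose_smul, Matrix.conjTranspose_sub,
    Matrix.conjTranspose_single, Matrix.conjTranspose_single, star_one, Complex.star_def, Complex.conj_I, neg_smul, ← smul_neg,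
    neg_sub]

/-- `tr(probe₁ · C) = C_ab + C_ba`, `tr(probe₂ · C) = i·(C_ab − C_ba)`. [folklore] -/
theorem trace_probe_mul (a b : n) (C : 𝕄) :
    (probe₁ a b * C).trace = C a b + C b a ∧ (probe₂ a b * C).trace = Complex.I * (C a b - C b a) := by
  refine ⟨?_, ?_⟩
  · rw [probe₁, add_mul, Matrix.trace_add, Matrix.trace_single_mul, Matrix.trace_single_mul, smul_eq_mul, smul_eq_mul, one_mul, one_mul]
  · rw [probe₂, Matrix.smul_mul, Matrix.trace_smul, sub_mul, Matrix.trace_sub, Matrix.trace_single_mul, Matrix.trace_single_mul,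
      smul_eq_mul, smul_eq_mul, smul_eq_mul, one_mul, one_mul]

/-- A single matrix unit has operator norm `≤ 1` (through the normalised Hilbert–Schmidt square). [folklore] -/
theorem norm_single_le (a b : n) : ‖(Matrix.single a b (1 : ℂ) : 𝕄)‖ ≤ 1 := by
  have hcard : (0 : ℝ) < Fintype.card n := by
    have : Nonempty n := ⟨a⟩
    exact_mod_cast Fintype.card_pos
  have h := opNorm_sq_le_card_mul_nhsNormSq (Matrix.single a b (1 : ℂ) : 𝕄)
  have hhs : nhsNormSq (Matrix.single a b (1 : ℂ) : 𝕄) = (Fintype.card n : ℝ)⁻¹ := by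
    unfold MatrixNorms.nhsNormSq
    have he : ∀ i j : n, ‖(Matrix.single a b (1 : ℂ) : 𝕄) i j‖ ^ 2 = if a = i then (if b = j then 1 else 0) else 0 := fun i j => by
      rw [Matrix.single_apply]; by_cases h1 : a = i <;> by_cases h2 : b = j <;> simp [h1, h2]
    have h2 : ∀ i : n, (∑ j : n, (if a = i then (if b = j then (1 : ℝ) else 0) else 0)) = if a = i then 1 else 0 := fun i => by
      split_ifs <;> simp
    simp_rw [he, h2, Finset.sum_ite_eq, Finset.mem_univ, if_true, one_div]
  rw [hhs, mul_inv_cancel₀ hcard.ne'] at h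
  nlinarith [norm_nonneg (Matrix.single a b (1 : ℂ) : 𝕄)]

/-- Both probes have operator norm `≤ 2`. [folklore] -/
theorem norm_probe_le (a b : n) : ‖(probe₁ a b : 𝕄)‖ ≤ 2 ∧ ‖(probe₂ a b : 𝕄)‖ ≤ 2 := by
  refine ⟨?_, ?_⟩
  · rw [probe₁]
    exact (norm_add_le _ _).trans (by linarith [norm_single_le (n := n) b a, norm_single_le (n := n) a b])
  · rw [probe₂, norm_smul, Complex.norm_I, one_mul]
    exact (norm_sub_le _ _).trans (by linarith [norm_single_le (n := n) b a, norm_single_le (n := n) a b])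

/-- **AN ENTRY FROM ITS TWO PROBES**: `‖C_ab‖ ≤ ‖exT (probe₁ a b) C‖ + ‖exT (probe₂ a b) C‖` (`2C_ab = tr(T₁C) − i·tr(T₂C)`). [folklore] -/
theorem norm_entry_le_probes (a b : n) (C : 𝕄) : ‖C a b‖ ≤ ‖exT (probe₁ a b) C‖ + ‖exT (probe₂ a b) C‖ := by
  rw [norm_exT, norm_exT, (trace_probe_mul a b C).1, (trace_probe_mul a b C).2]
  have hI : ∀ x : ℂ, -Complex.I * (Complex.I * x) = x := fun x => by rw [← mul_assoc, neg_mul, Complex.I_mul_I, neg_neg, one_mul]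
  have e : C a b = 2⁻¹ * (C a b + C b a) + 2⁻¹ * (-Complex.I * (Complex.I * (C a b - C b a))) := by rw [hI]; ring
  calc ‖C a b‖ = ‖2⁻¹ * (C a b + C b a) + 2⁻¹ * (-Complex.I * (Complex.I * (C a b - C b a)))‖ := by rw [← e]
    _ ≤ ‖2⁻¹ * (C a b + C b a)‖ + ‖2⁻¹ * (-Complex.I * (Complex.I * (C a b - C b a)))‖ := norm_add_le _ _
    _ = ‖C a b + C b a‖ / 2 + ‖Complex.I * (C a b - C b a)‖ / 2 := by
        simp only [norm_mul, norm_neg, Complex.norm_I, one_mul, norm_inv, Complex.norm_ofNat]; ring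

/-- **THE OPERATOR NORM FROM THE ENTRIES**: `‖C‖ ≤ Σ_a Σ_b ‖C_ab‖`. [folklore] -/
theorem opNorm_le_sum_norm_entries (C : 𝕄) : ‖C‖ ≤ ∑ a, ∑ b, ‖C a b‖ := by
  by_cases hn : Nonempty n
  · have hcard : (0 : ℝ) < Fintype.card n := by exact_mod_cast Fintype.card_pos
    have h := opNorm_sq_le_card_mul_nhsNormSq C
    have hsq : (Fintype.card n : ℝ) * nhsNormSq C = ∑ a, ∑ b, ‖C a b‖ ^ 2 := by
      unfold MatrixNorms.nhsNormSq; field_simp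
    rw [hsq] at h
    have hS0 : 0 ≤ ∑ a, ∑ b, ‖C a b‖ := Finset.sum_nonneg fun _ _ => Finset.sum_nonneg fun _ _ => norm_nonneg _
    have h2 : ∑ a, ∑ b, ‖C a b‖ ^ 2 ≤ (∑ a, ∑ b, ‖C a b‖) ^ 2 := by
      rw [sq, Finset.sum_mul]
      refine Finset.sum_le_sum fun a _ => ?_
      rw [Finset.sum_mul]
      refine Finset.sum_le_sum fun b _ => ?_
      rw [sq]
      exact mul_le_mul_of_nonneg_left ((Finset.single_le_sum (fun _ _ => norm_nonneg _) (Finset.mem_univ b)).trans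
        (Finset.single_le_sum (fun _ _ => Finset.sum_nonneg fun _ _ => norm_nonneg _) (Finset.mem_univ a))) (norm_nonneg _)
    calc ‖C‖ = Real.sqrt (‖C‖ ^ 2) := (Real.sqrt_sq (norm_nonneg _)).symm
      _ ≤ Real.sqrt ((∑ a, ∑ b, ‖C a b‖) ^ 2) := Real.sqrt_le_sqrt (h.trans h2)
      _ = ∑ a, ∑ b, ‖C a b‖ := Real.sqrt_sq hS0
  · have hC : C = 0 := Matrix.ext fun i _ => (hn ⟨i⟩).elim
    rw [hC, norm_zero]
    exact Finset.sum_nonneg fun _ _ => Finset.sum_nonneg fun _ _ => norm_nonneg _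

/-! ## §4 THE REDUCTION: the straight-slice letter for `M_n(ℂ)`-valued fields from the rank-one letter -/

/-- **`straightSliceSolver_of_rankOne`.**  HYPOTHESIS `h1` (DISPLAYED; the XL(c) content at rank one): the letter `G♭` with constant `K` on the straight slice
`{skew, P-periodic, (Qcoarse L)^[j] · = 0}` of `Matrix (Fin 1) (Fin 1) ℂ`-valued fields.  CONCLUSION: the same letter for `Matrix n n ℂ`-valued fields (the
hypothesis `hS` of (139) `NE7FlatSliceStraightReduction.sliceSolver_of_straightSliceSolver`), with constant `2·n³·K`. [folklore] -/
theorem straightSliceSolver_of_rankOne [Nonempty n] (L j P : ℕ) {K : ℝ}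
    (h1 : ∀ ξ : Site d → Fin d → 𝕄₁, IsSkewDir ξ → IsPeriodicDir ξ (P : ℤ) → (Qcoarse L)^[j] ξ = 0 → ∀ g : ℝ, 0 ≤ g →
      (∀ ζ : Site d → Fin d → 𝕄₁, IsSkewDir ζ → IsPeriodicDir ζ (P : ℤ) → (Qcoarse L)^[j] ζ = 0 →
        |hess (flat (d := d) (n := Fin 1)) ξ ζ (perWin d P)| ≤ g * dirL1 ζ (periodBox (d := d) P)) →
      ∀ (z : Site d) (μ ν : Fin d), μ ≠ ν → ‖curlAt (flat (d := d) (n := Fin 1)) ξ z μ ν‖ ≤ K * g) :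
    ∀ X : Site d → Fin d → 𝕄, IsSkewDir X → IsPeriodicDir X (P : ℤ) → (Qcoarse L)^[j] X = 0 → ∀ g : ℝ, 0 ≤ g →
      (∀ Y : Site d → Fin d → 𝕄, IsSkewDir Y → IsPeriodicDir Y (P : ℤ) → (Qcoarse L)^[j] Y = 0 →
        |hess (flat (d := d) (n := n)) X Y (perWin d P)| ≤ g * dirL1 Y (periodBox (d := d) P)) →
      ∀ (z : Site d) (μ ν : Fin d), μ ≠ ν →
        ‖curlAt (flat (d := d) (n := n)) X z μ ν‖ ≤ (2 * (Fintype.card n : ℝ) ^ 3 * K) * g := by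
  intro X hXs hXP hXQ g hg hfun z μ ν hμν
  set N : ℝ := (Fintype.card n : ℝ) with hN
  have hNpos : 0 < N := by rw [hN]; exact_mod_cast Fintype.card_pos
  -- one Hermitian probe `T` with `‖T‖ ≤ 2`: the rank-one letter for `exT T ∘ X` gives `‖exT T (curl X)‖ ≤ K·N·g`
  have hprobe : ∀ T : 𝕄, T ∈ selfAdjoint 𝕄 → ‖T‖ ≤ 2 → ‖exT T (curlAt (flat (d := d) (n := n)) X z μ ν)‖ ≤ K * (N * g) := by
    intro T hT hT2
    set ξ : Site d → Fin d → 𝕄₁ := fun y κ => exT T (X y κ) with hξ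
    have hξs : IsSkewDir ξ := fun y κ => exT_mem_skewAdjoint hT (hXs y κ)
    have hξP : IsPeriodicDir ξ (P : ℤ) := fun y κ κ' => by show exT T (X (y + (P : ℤ) • e κ) κ') = exT T (X y κ'); rw [hXP]
    have hξQ : (Qcoarse L)^[j] ξ = 0 := by
      rw [hξ, iterate_Qcoarse_map (exT T) L j X, hXQ]; funext w κ; simp only [Pi.zero_apply, map_zero]
    -- the functional bound for `ξ` against rank-one straight tests
    have hfun1 : ∀ ζ : Site d → Fin d → 𝕄₁, IsSkewDir ζ → IsPeriodicDir ζ (P : ℤ) → (Qcoarse L)^[j] ζ = 0 →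
        |hess (flat (d := d) (n := Fin 1)) ξ ζ (perWin d P)| ≤ (N * g) * dirL1 ζ (periodBox (d := d) P) := by
      intro ζ hζs hζP hζQ
      set Y : Site d → Fin d → 𝕄 := fun y κ => emT T (ζ y κ) with hY
      have hYs : IsSkewDir Y := fun y κ => emT_mem_skewAdjoint hT (hζs y κ)
      have hYP : IsPeriodicDir Y (P : ℤ) := fun y κ κ' => by show emT T (ζ (y + (P : ℤ) • e κ) κ') = emT T (ζ y κ'); rw [hζP]
      have hYQ : (Qcoarse L)^[j] Y = 0 := by
        rw [hY, iterate_Qcoarse_map (emT T) L j ζ, hζQ]; funext w κ; simp only [Pi.zero_apply, map_zero]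
      have hYg := hfun Y hYs hYP hYQ
      have hhess : hess (flat (d := d) (n := n)) X Y (perWin d P) = (2 / N) * hess (flat (d := d) (n := Fin 1)) ξ ζ (perWin d P) := by
        rw [hN]; exact hess_flat_emT T X ζ (perWin d P)
      have hY1 : dirL1 Y (periodBox (d := d) P) ≤ 2 * dirL1 ζ (periodBox (d := d) P) := by
        unfold dirL1
        rw [Finset.mul_sum]
        refine Finset.sum_le_sum fun x _ => ?_
        rw [Finset.mul_sum]
        refine Finset.sum_le_sum fun κ _ => ?_
        exact (norm_emT_le T _).trans (mul_le_mul_of_nonneg_right hT2 (norm_nonneg _))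
      have e1 : hess (flat (d := d) (n := Fin 1)) ξ ζ (perWin d P) = (N / 2) * hess (flat (d := d) (n := n)) X Y (perWin d P) := by
        rw [hhess]; field_simp
      rw [e1, abs_mul, abs_of_pos (by positivity : (0 : ℝ) < N / 2)]
      calc N / 2 * |hess (flat (d := d) (n := n)) X Y (perWin d P)| ≤ N / 2 * (g * dirL1 Y (periodBox (d := d) P)) := by gcongr
        _ ≤ N / 2 * (g * (2 * dirL1 ζ (periodBox (d := d) P))) := by gcongr
        _ = N * g * dirL1 ζ (periodBox (d := d) P) := by ring
    have h := h1 ξ hξs hξP hξQ (N * g) (by positivity) hfun1 z μ ν hμν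
    rwa [hξ, curlAt_flat_map] at h
  -- every entry of `curl X` from the two probes, then the operator norm from the entries
  set C : 𝕄 := curlAt (flat (d := d) (n := n)) X z μ ν with hC
  have hentry : ∀ a b : n, ‖C a b‖ ≤ 2 * (K * (N * g)) := fun a b =>
    (norm_entry_le_probes a b C).trans (by
      linarith [hprobe (probe₁ a b) (probe₁_mem_selfAdjoint a b) (norm_probe_le a b).1,
        hprobe (probe₂ a b) (probe₂_mem_selfAdjoint a b) (norm_probe_le a b).2])
  calc ‖C‖ ≤ ∑ a, ∑ b, ‖C a b‖ := opNorm_le_sum_norm_entries C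
    _ ≤ ∑ _a : n, ∑ _b : n, 2 * (K * (N * g)) := Finset.sum_le_sum fun a _ => Finset.sum_le_sum fun b _ => hentry a b
    _ = N * N * (2 * (K * (N * g))) := by rw [Finset.sum_const, Finset.sum_const, Finset.card_univ, nsmul_eq_mul, nsmul_eq_mul, hN]; ring
    _ = 2 * N ^ 3 * K * g := by ring

end

end Summit.QuantumFields.BalabanUV.T4Continuum.NE7FlatSliceRankOne
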